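import Mathlib
import HarnessLib
import Summits.Langlands.Langlands.Theses.SkinnerWilesDefectOne
import Summits.Langlands.Langlands.Theorems.SkinnerWilesDefectOneReducibleOrdinaryProModularDefs
import Summits.Langlands.Langlands.Theorems.SkinnerWilesDefectOneReducibleOrdinaryProModularSteinbergLocusCharZeroAux
import Summits.Langlands.Langlands.Theorems.SkinnerWilesDefectOneReducibleOrdinaryProModularComplementRegimeClosedPointAux
import Literature.NumberTheory.GaloisRepresentations.NearlyOrdinaryDeformationRing

/-!
# Strata bookkeeping on the reducible Steinberg locus: helper for the heart stub
# `stub_smallReducibleSteinbergLocusAligned` of line `steinberg-hyperplane`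
# (crux `ReducibleOrdinaryProModular`, stmt-Langlands-12919)

Route `SkinnerWilesDefectOne`.  Infrastructure only (it does NOT prove the heart stub): the claim
`SmallReducibleSteinbergLocus 𝓡 w` ("every reducible Steinberg-shaped prime `𝔮` of `R_𝒟` has
`dim R/𝔮 ≤ 3`") splits along the dichotomy *finite-order ratio / infinite-order ratio* of the diagonal
characters of `ρ_𝒟 mod 𝔮` into

* the **closed-point (constant-`Ψ`) stratum** — finite-order ratio; by the landed characteristic-zero
  exclusion (`not_hasFiniteOrderRatio_of_mem_steinbergLocus`, …SteinbergLocusCharZeroAux) such a prime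
  has `R/𝔮` of positive characteristic, hence (this file, `charZero_or_charP_quotient`: every prime
  quotient of the local ring `R_𝒟` with residue field `k` of characteristic `p` has characteristic `0` or
  `p`, as `ℓ ∈ 𝔮 ⊆ 𝔪_R = ker π` forces `ℓ = 0` in `k`) of characteristic EXACTLY `p`, where the regime
  predicate `ClosedPointStratumLE 𝓡 3` applies verbatim;
* the **moving strata** — infinite-order ratio (`Ψ(Frob_w) = q_w^{±1}`, the Λ-adic families on the two
  Steinberg hyperplanes), whose dimension bound is the genuine content of the heart stub and is taken
  here as the second hypothesis.

`smallReducibleSteinbergLocus_of_strata` records this reduction; `ModelData.*` are its specialisations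
to a model `M : ModelData F p` (bundled `CharP M.k p`), and the last theorem
`stub_smallReducibleSteinbergLocusAligned_auxStrata` is the registered one-line wrapper (sub-goal of
stmt-Langlands-12919) through which this helper lands.

References: C. M. Skinner, A. J. Wiles, *Residually reducible representations and modular forms*,
Publ. Math. IHÉS 89 (1999), §2.2 (Lemma 2.7: the constant-`Ψ` stratum) and §2.3; the line card
`Cruxes/ReducibleOrdinaryProModular/Lines/steinberg-hyperplane.md` (S3).  All proofs are elementary
commutative algebra over the tree's `NearlyOrdinaryDeformationRing` interface (`ker_π`). [folklore]
-/

set_option linter.dupNamespace false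
set_option autoImplicit false

namespace Summit.Langlands.Langlands.Cruxes.ReducibleOrdinaryProModular.SteinbergHyperplane

open scoped NumberField MatrixGroups
open Filter NumberField IsDedekindDomain Field Polynomial Matrix
open Literature.NumberTheory.Automorphic Literature.NumberTheory.Automorphic.BigHeckeGLn
open Literature.NumberTheory.GaloisRepresentations
open Summit.Langlands.Langlands.Theses.SkinnerWilesDefectOne

noncomputable section

section Strata

variable {F : Type} [Field F] [NumberField F] {p : ℕ} [Fact p.Prime]
variable {𝒪 : Type} [CommRing 𝒪] {k : Type} [Field k] [Algebra 𝒪 k] {𝒟 : NearlyOrdinaryDatum F p 𝒪 k}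
  (𝓡 : NearlyOrdinaryDeformationRing.{0} 𝒟)

/-- **Every prime quotient of `R_𝒟` has characteristic `0` or `p`.**  `R/𝔮` is a domain, so its
characteristic is `0` or a prime `ℓ`; in the latter case `(ℓ : R) ∈ 𝔮 ⊆ 𝔪_R = ker π`, so `(ℓ : k) = 0`
in the residue field `k` of characteristic `p`, whence `p ∣ ℓ` and `ℓ = p`. [folklore] -/
theorem charZero_or_charP_quotient [CharP k p] (𝔮 : PrimeSpectrum 𝓡.R) :
    CharZero (𝓡.R ⧸ 𝔮.asIdeal) ∨ CharP (𝓡.R ⧸ 𝔮.asIdeal) p := by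
  rcases CharP.exists' (𝓡.R ⧸ 𝔮.asIdeal) with h0 | ⟨ℓ, hℓ, hℓc⟩
  · exact Or.inl h0
  · right
    have hℓq : (ℓ : 𝓡.R) ∈ 𝔮.asIdeal := by
      rw [← Ideal.Quotient.eq_zero_iff_mem, map_natCast]
      exact CharP.cast_eq_zero _ ℓ
    have hℓm : (ℓ : 𝓡.R) ∈ IsLocalRing.maximalIdeal 𝓡.R :=
      IsLocalRing.le_maximalIdeal 𝔮.isPrime.ne_top hℓq
    have hℓk : (ℓ : k) = 0 := by
      rw [← 𝓡.ker_π, RingHom.mem_ker, map_natCast] at hℓm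
      exact hℓm
    have hpℓ : p = ℓ :=
      (Nat.prime_dvd_prime_iff_eq Fact.out hℓ.out).mp ((CharP.cast_eq_zero_iff k p ℓ).mp hℓk)
    exact CharP.congr ℓ hpℓ.symm

/-- **Strata bookkeeping.**  If the closed-point (finite-order-ratio, characteristic-`p`) stratum of the
reducible locus has dimension `≤ 3` and every reducible Steinberg-shaped prime with ratio of INFINITE
order has `dim R/𝔮 ≤ 3`, then the whole reducible Steinberg locus at `w` is small: a finite-order-ratio
prime on the Steinberg locus cannot have characteristic `0` (characteristic-zero exclusion), so it has
characteristic `p` and the first hypothesis applies. [folklore] -/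
theorem smallReducibleSteinbergLocus_of_strata [CharP k p] (w : HeightOneSpectrum (𝓞 F))
    (hcl : ClosedPointStratumLE 𝓡 3)
    (hmov : ∀ 𝔮 ∈ 𝓡.reducibleLocus ∩ steinbergLocus 𝓡 w, ¬ HasFiniteOrderRatio 𝓡 𝔮 →
      ringKrullDim (𝓡.R ⧸ 𝔮.asIdeal) ≤ 3) :
    SmallReducibleSteinbergLocus 𝓡 w := by
  intro 𝔮 h𝔮
  by_cases hfin : HasFiniteOrderRatio 𝓡 𝔮
  · rcases charZero_or_charP_quotient 𝓡 𝔮 with h0 | hp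
    · haveI := h0
      haveI := charZero_fractionRing_quotient 𝓡 𝔮
      exact absurd hfin (not_hasFiniteOrderRatio_of_mem_steinbergLocus 𝓡 h𝔮.1 h𝔮.2)
    · exact hcl 𝔮 h𝔮.1 hp hfin
  · exact hmov 𝔮 h𝔮 hfin

/-- (A) for a model `M : ModelData F p`: every prime quotient of `M.𝓡.R` has characteristic `0` or `p`.
[folklore] -/
theorem ModelData.charZero_or_charP_quotient (M : ModelData F p) (𝔮 : PrimeSpectrum M.𝓡.R) :
    CharZero (M.𝓡.R ⧸ 𝔮.asIdeal) ∨ CharP (M.𝓡.R ⧸ 𝔮.asIdeal) p :=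
  SteinbergHyperplane.charZero_or_charP_quotient M.𝓡 𝔮

/-- (B) for a model `M : ModelData F p`: closed-point stratum `≤ 3` and moving strata `≤ 3` give a small
reducible Steinberg locus of `M.𝓡` at `w`. [folklore] -/
theorem ModelData.smallReducibleSteinbergLocus_of_strata (M : ModelData F p)
    (w : HeightOneSpectrum (𝓞 F)) (hcl : ClosedPointStratumLE M.𝓡 3)
    (hmov : ∀ 𝔮 ∈ M.𝓡.reducibleLocus ∩ steinbergLocus M.𝓡 w, ¬ HasFiniteOrderRatio M.𝓡 𝔮 →
      ringKrullDim (M.𝓡.R ⧸ 𝔮.asIdeal) ≤ 3) :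
    SmallReducibleSteinbergLocus M.𝓡 w :=
  SteinbergHyperplane.smallReducibleSteinbergLocus_of_strata M.𝓡 w hcl hmov

end Strata

/-! ## Registered wrapper -/

/-- **Registered sub-goal of `stub_smallReducibleSteinbergLocusAligned` (strata bookkeeping): in a model
`M`, if the closed-point characteristic-`p` stratum of the reducible locus has dimension `≤ 3` and every
reducible Steinberg-shaped prime with infinite-order ratio has `dim ≤ 3`, then the reducible Steinberg
locus of `M.𝓡` at `w` is small.** [folklore] -/
theorem stub_smallReducibleSteinbergLocusAligned_auxStrata :
    ∀ (F : Type) [Field F] [NumberField F] (p : ℕ) [Fact p.Prime] (M : ModelData F p) (w : HeightOneSpectrum (𝓞 F)), ClosedPointStratumLE M.𝓡 3 → (∀ 𝔮 ∈ M.𝓡.reducibleLocus ∩ steinbergLocus M.𝓡 w, ¬ HasFiniteOrderRatio M.𝓡 𝔮 → ringKrullDim (M.𝓡.R ⧸ 𝔮.asIdeal) ≤ 3) → SmallReducibleSteinbergLocus M.𝓡 w :=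
  fun _ _ _ _ _ M w hcl hmov => M.smallReducibleSteinbergLocus_of_strata w hcl hmov

end

end Summit.Langlands.Langlands.Cruxes.ReducibleOrdinaryProModular.SteinbergHyperplane
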